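import Summits.QuantumFields.YangMills.Theorems.PoincareLipschitzSU2SphereDictionary
import Summits.QuantumFields.YangMills.Theorems.PoincareLipschitzLeungXinGraphStability
import HarnessLib

/-!
# Crux `HistoryTailL` (stmt-QuantumFields-19936), K2 organ of record «LOC-REG-MIN» (`hReg`; route crux `PoincareLipschitz.BlockLipschitzL`,
# stmt-QuantumFields-23533): TRANSFER — a box-`ℓ²`-gauge-orbit MINIMISER satisfies the twisted Leung–Xin stability hypothesis `hmin`

Cell `ym3-torus` (YM ladder rung R3 = continuum SU(2) Yang–Mills on T³ — a RUNG, NOT the Clay problem: not d = 4, not infinite volume, not a mass gap);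
width seat `ym-ust-19936-w2` g11, F6 pen (LEAD `ym-ust-19936-w1` g8 RULING 04:54:35Z «(T) = w2's T3-letter TRANSFER»).  Helper
`--supports stmt-QuantumFields-19936`; THEOREMS ONLY (0 `def`, 0 `sorry`), definition-free (the coordinate vector `v(U) = (Re U₀₀, Im U₀₀, Re U₁₀, Im U₁₀)`
is written out, as in ✓`PoincareLipschitzSU2SphereDictionary`).

WHAT IT DOES.  `hReg` (✓`PoincareLipschitzChartsOfOrbitMinRegularity`) quantifies over gauge copies `(ŪⁱU′)^h` MINIMISING the box-`ℓ²` orbit energy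
`k′ ↦ Σ_{b∈S} dist1(V_b·((W^h)^{k′})_b⁻¹)²` (`V = ŪⁱU`, `W = ŪⁱU′`, `S = S_i^M`).  The stability letters (LEAD ✓`…LeungXinGraphStability`, ★w8-19936 g6
`…LeungXinTwistedGraphStability.sum_energy_le_of_cutoff`) want, on a finite graph of bonds with orthogonal twists `S_b` (`S_bS_bᵀ = 1`), a unit-vector map `u`
and the hypothesis `hmin`: along each of the four Leung–Xin curves `U_t^a(x) = (1 + t²η_x²|v_a(u_x)|²)^{−1∕2}(u_x + tη_x v_a(u_x))` the twisted correlation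
does not increase, `Σ_b U_t^a(x)·S_bᵀU_t^a(y) ≤ Σ_b u_x·S_bᵀu_y`.  THIS FILE derives exactly that from the minimiser clause, in the tower's letters
(`Params`-generic, any finite bond set `S`, any cutoff `η`): with `u := v ∘ h` and `S_b := R_bᵀ`, `R_b` the orthogonal twist of `g ↦ V_b g W_b⁻¹`
(✓`exists_orthogonal_twist`), (i) `S_bS_bᵀ = 1`; (ii) the twist defect `‖S_b − 1‖_F² ≤ 8(dist1 V_b² + dist1 W_b²)` (small in a ball gauge); (iii) the
orbit-energy bond term IS the twisted Dirichlet bond energy `dist1(V_b·(W^h)_b⁻¹)² = |u_x − S_bᵀu_y|²`; (iv) `hmin` for every `η, a, t` — the competitor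
`k′ := g·h⁻¹` with `v(g_x) = U_t^a(x)` (✓`exists_su2_coords_eq`, unit by ✓`varied_dot_self`) is a gauge transformation, `(W^h)^{k′} = W^g`, and
`dist1(V_b·(W^g)_b⁻¹)² = 2 − 2·v(g_x)·R_b v(g_y)` (✓`dist1_bond_sq_eq`).  So ★w8's `sum_energy_le_of_cutoff` applies verbatim to box-ℓ²-orbit minimisers,
and with a ball cutoff (`κ = 2∕r`, `N ≍ 3(2r+1)³`) and a ball gauge (`δ² ≲ θ_i²r²`) gives the stability energy bound `E(B_{r∕2}) ≲ r + θ_i²r⁵` of LOC-REG-MIN.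

WHAT IS PROVED (ns `…Theorems.PoincareLipschitzOrbitMinLeungXinTransfer`).
* §1 `gaugeAct_gaugeAct_mul_inv` (`(W^h)^{g·h⁻¹} = W^g`), `sum_ite_mem_eq` (`Σ_b 𝟙[b∈S]f = Σ_{b:S} f`), `dot_mulVec_orthogonal` (`(Rx)·(Ry) = x·y`),
  `normSq_sub_eq_of_unit` (`|x − Ry|² = 2 − 2x·Ry` for unit `x, y`, orthogonal `R`).
* §2 ★★★ `leungXin_inputs_of_orbitMin (V W S h) (hmin : <hReg's minimiser clause, generic>) : ∃ Sm, (i) ∧ (ii) ∧ (iii) ∧ (iv)`.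
HONEST SCOPE.  A transfer lemma (algebra + one use of choice); the stability bound, the ball gauge, E→R and the ε-regularity of LOC-REG-MIN are NOT here;
nothing of stmt-QuantumFields-23533 ∕ 19936 is closed.  YM₃ on T³ is rung R3, not Clay; YM gap NOT proved.

References: T. Bałaban, CMP 109 (1987) 249–301 [Balaban1987RG1] ((0.14) p.254); Y. L. Xin, Duke Math. J. 47 (1980) 609–613 [Xin1980]; T. Kajigaya,
Ann. Mat. Pura Appl. (2023) [arXiv:2306.14098] (discrete Leung–Xin, Thm 1.2).
-/

set_option autoImplicit false

noncomputable section

open scoped BigOperators ComplexConjugate Matrix.Norms.L2Operator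
open Matrix

namespace Summit.QuantumFields.YangMills.Theorems.PoincareLipschitzOrbitMinLeungXinTransfer

open Literature.MathematicalPhysics.QuantumFieldTheory.Balaban1983to89
open Summit.QuantumFields.YangMills.Theorems.PoincareLipschitzSU2SphereDictionary (coords_dot_self dist1_bond_sq_eq exists_su2_coords_eq exists_orthogonal_twist)
open Summit.QuantumFields.YangMills.Theorems.PoincareLipschitzLeungXinGraphStability (varied_dot_self)

/-! ## §1 Letters -/

variable {P : Params} {i : ℕ}

/-- **THE ORBIT IS ONE ORBIT**: `(W^h)^{g·h⁻¹} = W^g` (bondwise `(g_xh_x⁻¹)(h_xW_bh_y⁻¹)(g_yh_y⁻¹)⁻¹ = g_xW_bg_y⁻¹`). [cite: Balaban1985Averaging, (8) p.19] -/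
theorem gaugeAct_gaugeAct_mul_inv (g h : GaugeTransf P i (Matrix.specialUnitaryGroup (Fin 2) ℂ))
    (W : GaugeField P i (Matrix.specialUnitaryGroup (Fin 2) ℂ)) (b : PBond P i) :
    GaugeField.gaugeAct (fun x => g x * (h x)⁻¹) (GaugeField.gaugeAct h W) b = GaugeField.gaugeAct g W b := by
  show g b.src * (h b.src)⁻¹ * (h b.src * W b * (h b.tgt)⁻¹) * (g b.tgt * (h b.tgt)⁻¹)⁻¹ = g b.src * W b * (g b.tgt)⁻¹
  group

/-- `Σ_b 𝟙[b ∈ S]·f b = Σ_{b : S} f b`. [folklore] -/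
theorem sum_ite_mem_eq [DecidableEq (PBond P i)] (S : Finset (PBond P i)) (f : PBond P i → ℝ) :
    (∑ b : PBond P i, if b ∈ S then f b else 0) = ∑ b : ↥S, f b.1 := by
  rw [Finset.sum_coe_sort S f, ← Finset.sum_filter, Finset.filter_mem_eq_inter, Finset.univ_inter]

/-- Orthogonal matrices preserve dot products: `(R x)·(R y) = x·y` for `Rᵀ R = 1`. [folklore] -/
theorem dot_mulVec_orthogonal {R : Matrix (Fin 4) (Fin 4) ℝ} (hR : Rᵀ * R = 1) (x y : Fin 4 → ℝ) :
    dotProduct (R *ᵥ x) (R *ᵥ y) = dotProduct x y := by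
  rw [← Matrix.vecMul_transpose, ← Matrix.dotProduct_mulVec, Matrix.mulVec_mulVec, hR, Matrix.one_mulVec]

/-- `|x − R y|² = 2 − 2·x·(R y)` for unit `x, y` and orthogonal `R`. [folklore] -/
theorem normSq_sub_eq_of_unit {R : Matrix (Fin 4) (Fin 4) ℝ} (hR : Rᵀ * R = 1) {x y : Fin 4 → ℝ} (hx : dotProduct x x = 1)
    (hy : dotProduct y y = 1) : dotProduct (x - R *ᵥ y) (x - R *ᵥ y) = 2 - 2 * dotProduct x (R *ᵥ y) := by
  rw [sub_dotProduct, dotProduct_sub, dotProduct_sub, hx, dot_mulVec_orthogonal hR, hy, dotProduct_comm (R *ᵥ y) x]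
  ring

/-! ## §2 The transfer -/

/-- ★★★ **A BOX-`ℓ²`-ORBIT MINIMISER SATISFIES THE TWISTED LEUNG–XIN HYPOTHESIS.**  For level-`i` fields `V, W`, a finite bond set `S` and a gauge
transformation `h` minimising `k′ ↦ Σ_{b∈S} dist1(V_b·((W^h)^{k′})_b⁻¹)²` (hReg's clause, `Params`-generic), there are bond twists `S_b` with
(i) `S_bS_bᵀ = 1`, (ii) `Σ_{a,i}(S_b − 1)_{ai}² ≤ 8(dist1 V_b² + dist1 W_b²)`, (iii) `dist1(V_b·(W^h)_b⁻¹)² = |u_x − S_bᵀu_y|²` (`u = v∘h`), and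
(iv) for every cutoff `η`, coordinate `a` and real `t`: `Σ_{b:S} U_t^a(b₋)·S_bᵀU_t^a(b₊) ≤ Σ_{b:S} u(b₋)·S_bᵀu(b₊)` — ★w8's `hmin` on the graph `S`
VERBATIM at `u := v∘h`. [cite: Balaban1987RG1, (0.14) p.254; Xin1980] -/
theorem leungXin_inputs_of_orbitMin [DecidableEq (PBond P i)]
    (V W : GaugeField P i (Matrix.specialUnitaryGroup (Fin 2) ℂ)) (S : Finset (PBond P i))
    (h : GaugeTransf P i (Matrix.specialUnitaryGroup (Fin 2) ℂ))
    (hmin : ∀ k' : GaugeTransf P i (Matrix.specialUnitaryGroup (Fin 2) ℂ),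
      (∑ b : PBond P i, if b ∈ S then GaugeGroup.dist1 (V b * (GaugeField.gaugeAct h W b)⁻¹) ^ 2 else 0) ≤
        ∑ b : PBond P i, if b ∈ S then GaugeGroup.dist1 (V b * (GaugeField.gaugeAct k' (GaugeField.gaugeAct h W) b)⁻¹) ^ 2 else 0) :
    ∃ Sm : PBond P i → Matrix (Fin 4) (Fin 4) ℝ,
      (∀ b, Sm b * (Sm b)ᵀ = 1) ∧
      (∀ b, ∑ a : Fin 4, ∑ i' : Fin 4, (Sm b a i' - (1 : Matrix (Fin 4) (Fin 4) ℝ) a i') ^ 2 ≤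
          8 * (GaugeGroup.dist1 (V b) ^ 2 + GaugeGroup.dist1 (W b) ^ 2)) ∧
      (∀ b : PBond P i, GaugeGroup.dist1 (V b * (GaugeField.gaugeAct h W b)⁻¹) ^ 2 = dotProduct (![(((h b.src : Matrix.specialUnitaryGroup (Fin 2) ℂ) : Matrix (Fin 2) (Fin 2) ℂ) 0 0).re, (((h b.src : Matrix.specialUnitaryGroup (Fin 2) ℂ) : Matrix (Fin 2) (Fin 2) ℂ) 0 0).im, (((h b.src : Matrix.specialUnitaryGroup (Fin 2) ℂ) : Matrix (Fin 2) (Fin 2) ℂ) 1 0).re, (((h b.src : Matrix.specialUnitaryGroup (Fin 2) ℂ) : Matrix (Fin 2) (Fin 2) ℂ) 1 0).im] - (Sm b)ᵀ *ᵥ ![(((h b.tgt : Matrix.specialUnitaryGroup (Fin 2) ℂ) : Matrix (Fin 2) (Fin 2) ℂ) 0 0).re, (((h b.tgt : Matrix.specialUnitaryGroup (Fin 2) ℂ) : Matrix (Fin 2) (Fin 2) ℂ) 0 0).im, (((h b.tgt : Matrix.specialUnitaryGroup (Fin 2) ℂ) : Matrix (Fin 2) (Fin 2) ℂ) 1 0).re,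 (((h b.tgt : Matrix.specialUnitaryGroup (Fin 2) ℂ) : Matrix (Fin 2) (Fin 2) ℂ) 1 0).im]) (![(((h b.src : Matrix.specialUnitaryGroup (Fin 2) ℂ) : Matrix (Fin 2) (Fin 2) ℂ) 0 0).re, (((h b.src : Matrix.specialUnitaryGroup (Fin 2) ℂ) : Matrix (Fin 2) (Fin 2) ℂ) 0 0).im, (((h b.src : Matrix.specialUnitaryGroup (Fin 2) ℂ) : Matrix (Fin 2) (Fin 2) ℂ) 1 0).re, (((h b.src : Matrix.specialUnitaryGroup (Fin 2) ℂ) : Matrix (Fin 2) (Fin 2) ℂ) 1 0).im] - (Sm b)ᵀ *ᵥ ![(((h b.tgt : Matrix.specialUnitaryGroup (Fin 2) ℂ) : Matrix (Fin 2) (Fin 2) ℂ) 0 0).re, (((h b.tgt : Matrix.specialUnitaryGroup (Fin 2) ℂ) : Matrix (Fin 2) (Fin 2) ℂ) 0 0).im, (((h b.tgt : Matrix.specialUnitaryGroup (Fin 2) ℂ) : Matrix (Fin 2) (Fin 2) ℂ) 1 0).re, (((h b.tgt : Matrix.specialUnitaryGroup (Fin 2) ℂ) : Matrix (Fin 2)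 (Fin 2) ℂ) 1 0).im])) ∧
      ∀ (η : Site P i → ℝ) (a : Fin 4) (t : ℝ), ∑ b : ↥S, dotProduct ((Real.sqrt (1 + t ^ 2 * dotProduct (η b.1.src • (Pi.single a 1 - dotProduct (Pi.single a 1) ![(((h b.1.src : Matrix.specialUnitaryGroup (Fin 2) ℂ) : Matrix (Fin 2) (Fin 2) ℂ) 0 0).re, (((h b.1.src : Matrix.specialUnitaryGroup (Fin 2) ℂ) : Matrix (Fin 2) (Fin 2) ℂ) 0 0).im, (((h b.1.src : Matrix.specialUnitaryGroup (Fin 2) ℂ) : Matrix (Fin 2) (Fin 2) ℂ) 1 0).re, (((h b.1.src : Matrix.specialUnitaryGroup (Fin 2) ℂ) : Matrix (Fin 2) (Fin 2) ℂ) 1 0).im] • ![(((h b.1.src : Matrix.specialUnitaryGroup (Fin 2) ℂ) : Matrix (Fin 2) (Fin 2) ℂ) 0 0).re, (((h b.1.src : Matrix.specialUnitaryGroup (Fin 2) ℂ) : Matrix (Fin 2) (Fin 2) ℂ) 0 0).im, (((h b.1.src : Matrix.specialUnitaryGroup (Fin 2) ℂ) : Matrix (Fin 2) (Fin 2) ℂ)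 1 0).re, (((h b.1.src : Matrix.specialUnitaryGroup (Fin 2) ℂ) : Matrix (Fin 2) (Fin 2) ℂ) 1 0).im])) (η b.1.src • (Pi.single a 1 - dotProduct (Pi.single a 1) ![(((h b.1.src : Matrix.specialUnitaryGroup (Fin 2) ℂ) : Matrix (Fin 2) (Fin 2) ℂ) 0 0).re, (((h b.1.src : Matrix.specialUnitaryGroup (Fin 2) ℂ) : Matrix (Fin 2) (Fin 2) ℂ) 0 0).im, (((h b.1.src : Matrix.specialUnitaryGroup (Fin 2) ℂ) : Matrix (Fin 2) (Fin 2) ℂ) 1 0).re, (((h b.1.src : Matrix.specialUnitaryGroup (Fin 2) ℂ) : Matrix (Fin 2) (Fin 2) ℂ) 1 0).im] • ![(((h b.1.src : Matrix.specialUnitaryGroup (Fin 2) ℂ) : Matrix (Fin 2) (Fin 2) ℂ) 0 0).re, (((h b.1.src : Matrix.specialUnitaryGroup (Fin 2) ℂ) : Matrix (Fin 2) (Fin 2) ℂ) 0 0).im, (((h b.1.src : Matrix.specialUnitaryGroup (Fin 2) ℂ) : Matrix (Fin 2) (Fin 2) ℂ) 1 0).re, (((h b.1.src : Matrix.specialUnitaryGroup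 (Fin 2) ℂ) : Matrix (Fin 2) (Fin 2) ℂ) 1 0).im]))))⁻¹ • (![(((h b.1.src : Matrix.specialUnitaryGroup (Fin 2) ℂ) : Matrix (Fin 2) (Fin 2) ℂ) 0 0).re, (((h b.1.src : Matrix.specialUnitaryGroup (Fin 2) ℂ) : Matrix (Fin 2) (Fin 2) ℂ) 0 0).im, (((h b.1.src : Matrix.specialUnitaryGroup (Fin 2) ℂ) : Matrix (Fin 2) (Fin 2) ℂ) 1 0).re, (((h b.1.src : Matrix.specialUnitaryGroup (Fin 2) ℂ) : Matrix (Fin 2) (Fin 2) ℂ) 1 0).im] + t • (η b.1.src • (Pi.single a 1 - dotProduct (Pi.single a 1) ![(((h b.1.src : Matrix.specialUnitaryGroup (Fin 2) ℂ) : Matrix (Fin 2) (Fin 2) ℂ) 0 0).re, (((h b.1.src : Matrix.specialUnitaryGroup (Fin 2) ℂ) : Matrix (Fin 2) (Fin 2) ℂ) 0 0).im, (((h b.1.src : Matrix.specialUnitaryGroup (Fin 2) ℂ) : Matrix (Fin 2) (Fin 2) ℂ) 1 0).re, (((h b.1.src : Matrix.specialUnitaryGroup (Fin 2) ℂ) :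 Matrix (Fin 2) (Fin 2) ℂ) 1 0).im] • ![(((h b.1.src : Matrix.specialUnitaryGroup (Fin 2) ℂ) : Matrix (Fin 2) (Fin 2) ℂ) 0 0).re, (((h b.1.src : Matrix.specialUnitaryGroup (Fin 2) ℂ) : Matrix (Fin 2) (Fin 2) ℂ) 0 0).im, (((h b.1.src : Matrix.specialUnitaryGroup (Fin 2) ℂ) : Matrix (Fin 2) (Fin 2) ℂ) 1 0).re, (((h b.1.src : Matrix.specialUnitaryGroup (Fin 2) ℂ) : Matrix (Fin 2) (Fin 2) ℂ) 1 0).im])))) ((Sm b.1)ᵀ *ᵥ ((Real.sqrt (1 + t ^ 2 * dotProduct (η b.1.tgt • (Pi.single a 1 - dotProduct (Pi.single a 1) ![(((h b.1.tgt : Matrix.specialUnitaryGroup (Fin 2) ℂ) : Matrix (Fin 2) (Fin 2) ℂ) 0 0).re, (((h b.1.tgt : Matrix.specialUnitaryGroup (Fin 2) ℂ) : Matrix (Fin 2) (Fin 2) ℂ) 0 0).im, (((h b.1.tgt : Matrix.specialUnitaryGroup (Fin 2) ℂ) : Matrix (Fin 2) (Fin 2) ℂ) 1 0).re, (((h b.1.tgt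 : Matrix.specialUnitaryGroup (Fin 2) ℂ) : Matrix (Fin 2) (Fin 2) ℂ) 1 0).im] • ![(((h b.1.tgt : Matrix.specialUnitaryGroup (Fin 2) ℂ) : Matrix (Fin 2) (Fin 2) ℂ) 0 0).re, (((h b.1.tgt : Matrix.specialUnitaryGroup (Fin 2) ℂ) : Matrix (Fin 2) (Fin 2) ℂ) 0 0).im, (((h b.1.tgt : Matrix.specialUnitaryGroup (Fin 2) ℂ) : Matrix (Fin 2) (Fin 2) ℂ) 1 0).re, (((h b.1.tgt : Matrix.specialUnitaryGroup (Fin 2) ℂ) : Matrix (Fin 2) (Fin 2) ℂ) 1 0).im])) (η b.1.tgt • (Pi.single a 1 - dotProduct (Pi.single a 1) ![(((h b.1.tgt : Matrix.specialUnitaryGroup (Fin 2) ℂ) : Matrix (Fin 2) (Fin 2) ℂ) 0 0).re, (((h b.1.tgt : Matrix.specialUnitaryGroup (Fin 2) ℂ) : Matrix (Fin 2) (Fin 2) ℂ) 0 0).im, (((h b.1.tgt : Matrix.specialUnitaryGroup (Fin 2) ℂ) : Matrix (Fin 2) (Fin 2) ℂ) 1 0).re, (((h b.1.tgt : Matrix.specialUnitaryGroup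 (Fin 2) ℂ) : Matrix (Fin 2) (Fin 2) ℂ) 1 0).im] • ![(((h b.1.tgt : Matrix.specialUnitaryGroup (Fin 2) ℂ) : Matrix (Fin 2) (Fin 2) ℂ) 0 0).re, (((h b.1.tgt : Matrix.specialUnitaryGroup (Fin 2) ℂ) : Matrix (Fin 2) (Fin 2) ℂ) 0 0).im, (((h b.1.tgt : Matrix.specialUnitaryGroup (Fin 2) ℂ) : Matrix (Fin 2) (Fin 2) ℂ) 1 0).re, (((h b.1.tgt : Matrix.specialUnitaryGroup (Fin 2) ℂ) : Matrix (Fin 2) (Fin 2) ℂ) 1 0).im]))))⁻¹ • (![(((h b.1.tgt : Matrix.specialUnitaryGroup (Fin 2) ℂ) : Matrix (Fin 2) (Fin 2) ℂ) 0 0).re, (((h b.1.tgt : Matrix.specialUnitaryGroup (Fin 2) ℂ) : Matrix (Fin 2) (Fin 2) ℂ) 0 0).im, (((h b.1.tgt : Matrix.specialUnitaryGroup (Fin 2) ℂ) : Matrix (Fin 2) (Fin 2) ℂ) 1 0).re, (((h b.1.tgt : Matrix.specialUnitaryGroup (Fin 2) ℂ) : Matrix (Fin 2) (Fin 2) ℂ)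 1 0).im] + t • (η b.1.tgt • (Pi.single a 1 - dotProduct (Pi.single a 1) ![(((h b.1.tgt : Matrix.specialUnitaryGroup (Fin 2) ℂ) : Matrix (Fin 2) (Fin 2) ℂ) 0 0).re, (((h b.1.tgt : Matrix.specialUnitaryGroup (Fin 2) ℂ) : Matrix (Fin 2) (Fin 2) ℂ) 0 0).im, (((h b.1.tgt : Matrix.specialUnitaryGroup (Fin 2) ℂ) : Matrix (Fin 2) (Fin 2) ℂ) 1 0).re, (((h b.1.tgt : Matrix.specialUnitaryGroup (Fin 2) ℂ) : Matrix (Fin 2) (Fin 2) ℂ) 1 0).im] • ![(((h b.1.tgt : Matrix.specialUnitaryGroup (Fin 2) ℂ) : Matrix (Fin 2) (Fin 2) ℂ) 0 0).re, (((h b.1.tgt : Matrix.specialUnitaryGroup (Fin 2) ℂ) : Matrix (Fin 2) (Fin 2) ℂ) 0 0).im, (((h b.1.tgt : Matrix.specialUnitaryGroup (Fin 2) ℂ) : Matrix (Fin 2) (Fin 2) ℂ) 1 0).re, (((h b.1.tgt : Matrix.specialUnitaryGroup (Fin 2) ℂ) : Matrix (Fin 2) (Fin 2) ℂ) 1 0).im])))))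 ≤ ∑ b : ↥S, dotProduct ![(((h b.1.src : Matrix.specialUnitaryGroup (Fin 2) ℂ) : Matrix (Fin 2) (Fin 2) ℂ) 0 0).re, (((h b.1.src : Matrix.specialUnitaryGroup (Fin 2) ℂ) : Matrix (Fin 2) (Fin 2) ℂ) 0 0).im, (((h b.1.src : Matrix.specialUnitaryGroup (Fin 2) ℂ) : Matrix (Fin 2) (Fin 2) ℂ) 1 0).re, (((h b.1.src : Matrix.specialUnitaryGroup (Fin 2) ℂ) : Matrix (Fin 2) (Fin 2) ℂ) 1 0).im] ((Sm b.1)ᵀ *ᵥ ![(((h b.1.tgt : Matrix.specialUnitaryGroup (Fin 2) ℂ) : Matrix (Fin 2) (Fin 2) ℂ) 0 0).re, (((h b.1.tgt : Matrix.specialUnitaryGroup (Fin 2) ℂ) : Matrix (Fin 2) (Fin 2) ℂ) 0 0).im, (((h b.1.tgt : Matrix.specialUnitaryGroup (Fin 2) ℂ) : Matrix (Fin 2) (Fin 2) ℂ) 1 0).re, (((h b.1.tgt : Matrix.specialUnitaryGroup (Fin 2) ℂ) : Matrix (Fin 2) (Fin 2) ℂ) 1 0).im]) := by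
  -- the bond twists
  choose R hRorth hRdef hRtw using fun b : PBond P i => exists_orthogonal_twist (V b) (W b)⁻¹
  have hu : ∀ x : Site P i, dotProduct ![(((h x : Matrix.specialUnitaryGroup (Fin 2) ℂ) : Matrix (Fin 2) (Fin 2) ℂ) 0 0).re, (((h x : Matrix.specialUnitaryGroup (Fin 2) ℂ) : Matrix (Fin 2) (Fin 2) ℂ) 0 0).im, (((h x : Matrix.specialUnitaryGroup (Fin 2) ℂ) : Matrix (Fin 2) (Fin 2) ℂ) 1 0).re, (((h x : Matrix.specialUnitaryGroup (Fin 2) ℂ) : Matrix (Fin 2) (Fin 2) ℂ) 1 0).im] ![(((h x : Matrix.specialUnitaryGroup (Fin 2) ℂ) : Matrix (Fin 2) (Fin 2) ℂ) 0 0).re, (((h x : Matrix.specialUnitaryGroup (Fin 2) ℂ) : Matrix (Fin 2) (Fin 2) ℂ) 0 0).im, (((h x : Matrix.specialUnitaryGroup (Fin 2) ℂ) : Matrix (Fin 2) (Fin 2) ℂ) 1 0).re, (((h x : Matrix.specialUnitaryGroup (Fin 2) ℂ) : Matrix (Fin 2) (Fin 2) ℂ) 1 0).im] = 1 := fun x =>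 coords_dot_self (h x)
  -- the bond term at any gauge transformation `g`: `dist1(V_b (W^g)_b⁻¹)² = 2 − 2 v(g_x)·R_b v(g_y)`
  have hbond : ∀ (g : GaugeTransf P i (Matrix.specialUnitaryGroup (Fin 2) ℂ)) (b : PBond P i),
      GaugeGroup.dist1 (V b * (GaugeField.gaugeAct g W b)⁻¹) ^ 2 = 2 - 2 * dotProduct ![(((g b.src : Matrix.specialUnitaryGroup (Fin 2) ℂ) : Matrix (Fin 2) (Fin 2) ℂ) 0 0).re, (((g b.src : Matrix.specialUnitaryGroup (Fin 2) ℂ) : Matrix (Fin 2) (Fin 2) ℂ) 0 0).im, (((g b.src : Matrix.specialUnitaryGroup (Fin 2) ℂ) : Matrix (Fin 2) (Fin 2) ℂ) 1 0).re, (((g b.src : Matrix.specialUnitaryGroup (Fin 2) ℂ) : Matrix (Fin 2) (Fin 2) ℂ) 1 0).im] (R b *ᵥ ![(((g b.tgt : Matrix.specialUnitaryGroup (Fin 2) ℂ) : Matrix (Fin 2) (Fin 2) ℂ) 0 0).re, (((g b.tgt : Matrix.specialUnitaryGroup (Fin 2) ℂ) : Matrix (Fin 2) (Fin 2) ℂ)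 0 0).im, (((g b.tgt : Matrix.specialUnitaryGroup (Fin 2) ℂ) : Matrix (Fin 2) (Fin 2) ℂ) 1 0).re, (((g b.tgt : Matrix.specialUnitaryGroup (Fin 2) ℂ) : Matrix (Fin 2) (Fin 2) ℂ) 1 0).im]) := by
    intro g b
    rw [dist1_bond_sq_eq V W g b, hRtw b (g b.tgt)]
  refine ⟨fun b => (R b)ᵀ, fun b => by rw [Matrix.transpose_transpose]; exact hRorth b, fun b => ?_, fun b => ?_, fun η a t => ?_⟩
  · -- (ii) the defect, re-indexed
    have h1 : ∀ a i' : Fin 4, (1 : Matrix (Fin 4) (Fin 4) ℝ) a i' = (1 : Matrix (Fin 4) (Fin 4) ℝ) i' a := fun a i' => by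
      rw [← Matrix.transpose_apply (1 : Matrix (Fin 4) (Fin 4) ℝ) a i', Matrix.transpose_one]
    calc ∑ a : Fin 4, ∑ i' : Fin 4, ((R b)ᵀ a i' - (1 : Matrix (Fin 4) (Fin 4) ℝ) a i') ^ 2
        = ∑ i' : Fin 4, ∑ a : Fin 4, (R b i' a - (1 : Matrix (Fin 4) (Fin 4) ℝ) i' a) ^ 2 := by
          rw [Finset.sum_comm]
          refine Finset.sum_congr rfl fun i' _ => Finset.sum_congr rfl fun a _ => ?_
          rw [Matrix.transpose_apply, h1]
      _ ≤ 8 * (GaugeGroup.dist1 (V b) ^ 2 + GaugeGroup.dist1 (W b)⁻¹ ^ 2) := hRdef b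
      _ = 8 * (GaugeGroup.dist1 (V b) ^ 2 + GaugeGroup.dist1 (W b) ^ 2) := by rw [GaugeGroup.dist1_inv]
  · -- (iii) the energy identity
    rw [Matrix.transpose_transpose, hbond h b, normSq_sub_eq_of_unit (hRorth b) (hu b.src) (hu b.tgt)]
  · -- (iv) the competitor `g·h⁻¹`, `v(g_x) = U_t^a(x)`
    have hunit : ∀ x : Site P i, dotProduct ((Real.sqrt (1 + t ^ 2 * dotProduct (η x • (Pi.single a 1 - dotProduct (Pi.single a 1) ![(((h x : Matrix.specialUnitaryGroup (Fin 2) ℂ) : Matrix (Fin 2) (Fin 2) ℂ) 0 0).re, (((h x : Matrix.specialUnitaryGroup (Fin 2) ℂ) : Matrix (Fin 2) (Fin 2) ℂ) 0 0).im, (((h x : Matrix.specialUnitaryGroup (Fin 2) ℂ) : Matrix (Fin 2) (Fin 2) ℂ) 1 0).re, (((h x : Matrix.specialUnitaryGroup (Fin 2) ℂ) : Matrix (Fin 2) (Fin 2) ℂ) 1 0).im] • ![(((h x : Matrix.specialUnitaryGroup (Fin 2) ℂ) : Matrix (Fin 2) (Fin 2) ℂ) 0 0).re, (((h x : Matrix.specialUnitaryGroup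 (Fin 2) ℂ) : Matrix (Fin 2) (Fin 2) ℂ) 0 0).im, (((h x : Matrix.specialUnitaryGroup (Fin 2) ℂ) : Matrix (Fin 2) (Fin 2) ℂ) 1 0).re, (((h x : Matrix.specialUnitaryGroup (Fin 2) ℂ) : Matrix (Fin 2) (Fin 2) ℂ) 1 0).im])) (η x • (Pi.single a 1 - dotProduct (Pi.single a 1) ![(((h x : Matrix.specialUnitaryGroup (Fin 2) ℂ) : Matrix (Fin 2) (Fin 2) ℂ) 0 0).re, (((h x : Matrix.specialUnitaryGroup (Fin 2) ℂ) : Matrix (Fin 2) (Fin 2) ℂ) 0 0).im, (((h x : Matrix.specialUnitaryGroup (Fin 2) ℂ) : Matrix (Fin 2) (Fin 2) ℂ) 1 0).re, (((h x : Matrix.specialUnitaryGroup (Fin 2) ℂ) : Matrix (Fin 2) (Fin 2) ℂ) 1 0).im] • ![(((h x : Matrix.specialUnitaryGroup (Fin 2) ℂ) : Matrix (Fin 2) (Fin 2) ℂ) 0 0).re, (((h x : Matrix.specialUnitaryGroup (Fin 2) ℂ) : Matrix (Fin 2) (Fin 2) ℂ) 0 0).im, (((h x : Matrix.specialUnitaryGroup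 (Fin 2) ℂ) : Matrix (Fin 2) (Fin 2) ℂ) 1 0).re, (((h x : Matrix.specialUnitaryGroup (Fin 2) ℂ) : Matrix (Fin 2) (Fin 2) ℂ) 1 0).im]))))⁻¹ • (![(((h x : Matrix.specialUnitaryGroup (Fin 2) ℂ) : Matrix (Fin 2) (Fin 2) ℂ) 0 0).re, (((h x : Matrix.specialUnitaryGroup (Fin 2) ℂ) : Matrix (Fin 2) (Fin 2) ℂ) 0 0).im, (((h x : Matrix.specialUnitaryGroup (Fin 2) ℂ) : Matrix (Fin 2) (Fin 2) ℂ) 1 0).re, (((h x : Matrix.specialUnitaryGroup (Fin 2) ℂ) : Matrix (Fin 2) (Fin 2) ℂ) 1 0).im] + t • (η x • (Pi.single a 1 - dotProduct (Pi.single a 1) ![(((h x : Matrix.specialUnitaryGroup (Fin 2) ℂ) : Matrix (Fin 2) (Fin 2) ℂ) 0 0).re, (((h x : Matrix.specialUnitaryGroup (Fin 2) ℂ) : Matrix (Fin 2) (Fin 2) ℂ) 0 0).im, (((h x : Matrix.specialUnitaryGroup (Fin 2) ℂ) : Matrix (Fin 2) (Fin 2) ℂ) 1 0).re, (((h x : Matrix.specialUnitaryGroup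 (Fin 2) ℂ) : Matrix (Fin 2) (Fin 2) ℂ) 1 0).im] • ![(((h x : Matrix.specialUnitaryGroup (Fin 2) ℂ) : Matrix (Fin 2) (Fin 2) ℂ) 0 0).re, (((h x : Matrix.specialUnitaryGroup (Fin 2) ℂ) : Matrix (Fin 2) (Fin 2) ℂ) 0 0).im, (((h x : Matrix.specialUnitaryGroup (Fin 2) ℂ) : Matrix (Fin 2) (Fin 2) ℂ) 1 0).re, (((h x : Matrix.specialUnitaryGroup (Fin 2) ℂ) : Matrix (Fin 2) (Fin 2) ℂ) 1 0).im])))) ((Real.sqrt (1 + t ^ 2 * dotProduct (η x • (Pi.single a 1 - dotProduct (Pi.single a 1) ![(((h x : Matrix.specialUnitaryGroup (Fin 2) ℂ) : Matrix (Fin 2) (Fin 2) ℂ) 0 0).re, (((h x : Matrix.specialUnitaryGroup (Fin 2) ℂ) : Matrix (Fin 2) (Fin 2) ℂ) 0 0).im, (((h x : Matrix.specialUnitaryGroup (Fin 2) ℂ) : Matrix (Fin 2) (Fin 2) ℂ) 1 0).re, (((h x : Matrix.specialUnitaryGroup (Fin 2) ℂ) : Matrix (Fin 2) (Fin 2) ℂ)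 1 0).im] • ![(((h x : Matrix.specialUnitaryGroup (Fin 2) ℂ) : Matrix (Fin 2) (Fin 2) ℂ) 0 0).re, (((h x : Matrix.specialUnitaryGroup (Fin 2) ℂ) : Matrix (Fin 2) (Fin 2) ℂ) 0 0).im, (((h x : Matrix.specialUnitaryGroup (Fin 2) ℂ) : Matrix (Fin 2) (Fin 2) ℂ) 1 0).re, (((h x : Matrix.specialUnitaryGroup (Fin 2) ℂ) : Matrix (Fin 2) (Fin 2) ℂ) 1 0).im])) (η x • (Pi.single a 1 - dotProduct (Pi.single a 1) ![(((h x : Matrix.specialUnitaryGroup (Fin 2) ℂ) : Matrix (Fin 2) (Fin 2) ℂ) 0 0).re, (((h x : Matrix.specialUnitaryGroup (Fin 2) ℂ) : Matrix (Fin 2) (Fin 2) ℂ) 0 0).im, (((h x : Matrix.specialUnitaryGroup (Fin 2) ℂ) : Matrix (Fin 2) (Fin 2) ℂ) 1 0).re, (((h x : Matrix.specialUnitaryGroup (Fin 2) ℂ) : Matrix (Fin 2) (Fin 2) ℂ) 1 0).im] • ![(((h x : Matrix.specialUnitaryGroup (Fin 2) ℂ) : Matrix (Fin 2) (Fin 2)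 ℂ) 0 0).re, (((h x : Matrix.specialUnitaryGroup (Fin 2) ℂ) : Matrix (Fin 2) (Fin 2) ℂ) 0 0).im, (((h x : Matrix.specialUnitaryGroup (Fin 2) ℂ) : Matrix (Fin 2) (Fin 2) ℂ) 1 0).re, (((h x : Matrix.specialUnitaryGroup (Fin 2) ℂ) : Matrix (Fin 2) (Fin 2) ℂ) 1 0).im]))))⁻¹ • (![(((h x : Matrix.specialUnitaryGroup (Fin 2) ℂ) : Matrix (Fin 2) (Fin 2) ℂ) 0 0).re, (((h x : Matrix.specialUnitaryGroup (Fin 2) ℂ) : Matrix (Fin 2) (Fin 2) ℂ) 0 0).im, (((h x : Matrix.specialUnitaryGroup (Fin 2) ℂ) : Matrix (Fin 2) (Fin 2) ℂ) 1 0).re, (((h x : Matrix.specialUnitaryGroup (Fin 2) ℂ) : Matrix (Fin 2) (Fin 2) ℂ) 1 0).im] + t • (η x • (Pi.single a 1 - dotProduct (Pi.single a 1) ![(((h x : Matrix.specialUnitaryGroup (Fin 2) ℂ) : Matrix (Fin 2) (Fin 2) ℂ) 0 0).re, (((h x : Matrix.specialUnitaryGroup (Fin 2) ℂ) : Matrix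 (Fin 2) (Fin 2) ℂ) 0 0).im, (((h x : Matrix.specialUnitaryGroup (Fin 2) ℂ) : Matrix (Fin 2) (Fin 2) ℂ) 1 0).re, (((h x : Matrix.specialUnitaryGroup (Fin 2) ℂ) : Matrix (Fin 2) (Fin 2) ℂ) 1 0).im] • ![(((h x : Matrix.specialUnitaryGroup (Fin 2) ℂ) : Matrix (Fin 2) (Fin 2) ℂ) 0 0).re, (((h x : Matrix.specialUnitaryGroup (Fin 2) ℂ) : Matrix (Fin 2) (Fin 2) ℂ) 0 0).im, (((h x : Matrix.specialUnitaryGroup (Fin 2) ℂ) : Matrix (Fin 2) (Fin 2) ℂ) 1 0).re, (((h x : Matrix.specialUnitaryGroup (Fin 2) ℂ) : Matrix (Fin 2) (Fin 2) ℂ) 1 0).im])))) = 1 := fun x => varied_dot_self (fun x => ![(((h x : Matrix.specialUnitaryGroup (Fin 2) ℂ) : Matrix (Fin 2) (Fin 2) ℂ) 0 0).re, (((h x : Matrix.specialUnitaryGroup (Fin 2) ℂ) : Matrix (Fin 2) (Fin 2) ℂ) 0 0).im, (((h x : Matrix.specialUnitaryGroup (Fin 2) ℂ) : Matrix (Fin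 2) (Fin 2) ℂ) 1 0).re, (((h x : Matrix.specialUnitaryGroup (Fin 2) ℂ) : Matrix (Fin 2) (Fin 2) ℂ) 1 0).im]) hu η a t x
    choose g hg using fun x : Site P i => exists_su2_coords_eq _ (hunit x)
    have key := hmin (fun x => g x * (h x)⁻¹)
    simp only [gaugeAct_gaugeAct_mul_inv] at key
    rw [sum_ite_mem_eq, sum_ite_mem_eq] at key
    simp only [hbond, hg, Matrix.transpose_transpose] at key ⊢
    have e2 : ∀ (f : ↥S → ℝ), ∑ b : ↥S, (2 - 2 * f b) = 2 * (Fintype.card ↥S : ℝ) - 2 * ∑ b : ↥S, f b := fun f => by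
      rw [Finset.sum_sub_distrib, Finset.sum_const, Finset.card_univ, nsmul_eq_mul, Finset.mul_sum]
      ring
    rw [e2, e2] at key
    linarith

end Summit.QuantumFields.YangMills.Theorems.PoincareLipschitzOrbitMinLeungXinTransfer

end
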